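import Literature.NumberTheory.Sieve.RoughNumbersBuchstabPrimeSum
import HarnessLib

/-!
# The prime sum of the Buchstab iteration for `k ≥ 3`

Topic `Literature/NumberTheory/Sieve`. Everything here is PROVED. Companion of
`RoughNumbersBuchstabPrimeSum.lean` (the main term and the case `k = 2`): for `k ≥ 3` the points
`s = log x/log p − 1` with `y ≤ p < x^{1/k}` lie in `(2, ∞)`, where Buchstab's `ω` is `C¹`
(`hasDerivAt_buchstabOmega`, `|ω'| ≤ 1/4`), so the weight
`f(t) = x ω(log x/log t − 1)/(t log² t)` is `C¹` on `[a, b]` with `|f| ≤ x/(t log² t)` and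
`|f'| ≤ (k + 4) x/(t² log² t)`; Abel summation through `ϑ`
(`abs_sum_sub_integral_le_of_weight_bounds`) gives

`|∑_{⌊a⌋ < p ≤ ⌊b⌋} x ω(log x/log p − 1)/(p log p) − ∫_a^b f| ≤ (3k + 14) C₀ x/log² a`

(`abs_sum_sub_integral_le_of_three_le`). This is the analytic input of the inductive step
`k → k + 1` (`k ≥ 3`) of Lichtman's Lemma 6.1 (`RoughNumbersBuchstab.lean`).

## References

* J. D. Lichtman, arXiv:2109.02851, §6.1, Lemma 6.1. [Lichtman2025LinearSieve]
* G. Harman, *Prime-Detecting Sieves* (2007), Appendix A.2.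
-/

open Finset Real MeasureTheory Set intervalIntegral
open scoped Chebyshev

noncomputable section

namespace Literature.NumberTheory.Sieve

/-- For `t ∈ [a, b]` with `e ≤ a` and `k log b < log x` (`k ≥ 3`): `t > 0`, `log t ≥ 1` and
`log x/log t − 1 > 2`. [folklore] -/
private theorem aux_mem_three {k : ℕ} (hk : 3 ≤ k) {x a b t : ℝ} (ha : Real.exp 1 ≤ a)
    (hbx : k * Real.log b < Real.log x) (ht : t ∈ Icc a b) :
    0 < t ∧ 1 ≤ Real.log t ∧ 2 < Real.log x / Real.log t - 1 := by
  have ha0 : 0 < a := (Real.exp_pos 1).trans_le ha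
  have ht0 : 0 < t := ha0.trans_le ht.1
  have hlt : 1 ≤ Real.log t := by
    rw [Real.le_log_iff_exp_le ht0]; exact ha.trans ht.1
  have hltb : Real.log t ≤ Real.log b := Real.log_le_log ht0 ht.2
  have hk3 : (3 : ℝ) ≤ k := by exact_mod_cast hk
  refine ⟨ht0, hlt, ?_⟩
  rw [lt_sub_iff_add_lt, lt_div_iff₀ (by linarith)]
  nlinarith

/-- **The prime sum of the Buchstab iteration, `k ≥ 3`.** For `e ≤ a ≤ b`, `k log b < log x`,
`log x ≤ 2(k + 1) log a`, `log b ≤ 3 log a`, `x ≥ 0` and `|ϑ(t) − t| ≤ C₀ t/log² t` (`t ≥ 2`):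
`|∑_{⌊a⌋ < p ≤ ⌊b⌋} x ω(log x/log p − 1)/(p log p) − ∫_a^b x ω(log x/log t − 1) dt/(t log² t)|`
`≤ (3k + 14) C₀ x/log² a`. [cite: Lichtman2025LinearSieve, Lemma 6.1] -/
theorem abs_sum_sub_integral_le_of_three_le {k : ℕ} (hk : 3 ≤ k) {x a b C₀ : ℝ} (hC₀ : 0 ≤ C₀)
    (hE : ∀ t : ℝ, 2 ≤ t → |θ t - t| ≤ C₀ * t / Real.log t ^ 2)
    (ha : Real.exp 1 ≤ a) (hab : a ≤ b) (hbx : k * Real.log b < Real.log x)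
    (hxa : Real.log x ≤ 2 * (k + 1) * Real.log a) (hba : Real.log b ≤ 3 * Real.log a) (hx : 0 ≤ x) :
    |∑ p ∈ (Finset.Ioc ⌊a⌋₊ ⌊b⌋₊).filter Nat.Prime,
        x * buchstabOmega (Real.log x / Real.log p - 1) / (p * Real.log p) -
      ∫ t in a..b, x * buchstabOmega (Real.log x / Real.log t - 1) / (t * Real.log t ^ 2)| ≤
      (3 * k + 14) * C₀ * x / Real.log a ^ 2 := by
  have ha0 : 0 < a := (Real.exp_pos 1).trans_le ha
  have hL0 : 0 ≤ Real.log x := by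
    obtain ⟨-, hla, h2⟩ := aux_mem_three hk ha hbx ⟨le_rfl, hab⟩
    have : 0 < Real.log x / Real.log a := by linarith
    exact (div_pos_iff_of_pos_right (by linarith)).mp this |>.le
  -- the weight and its derivative
  set f : ℝ → ℝ := fun t => x * buchstabOmega (Real.log x / Real.log t - 1) / (t * Real.log t ^ 2)
    with hf_def
  set f' : ℝ → ℝ := fun t =>
    (x * ((buchstabOmega (Real.log x / Real.log t - 1 - 1) - buchstabOmega (Real.log x / Real.log t - 1)) /
        (Real.log x / Real.log t - 1) * (-Real.log x / (t * Real.log t ^ 2))) * (t * Real.log t ^ 2) -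
      x * buchstabOmega (Real.log x / Real.log t - 1) * (Real.log t ^ 2 + 2 * Real.log t)) /
    (t * Real.log t ^ 2) ^ 2 with hf'_def
  have hf : ∀ t ∈ Icc a b, HasDerivAt f (f' t) t := by
    intro t ht
    obtain ⟨ht0, hlt, hφ2⟩ := aux_mem_three hk ha hbx ht
    have ht1 : 1 < t := by
      by_contra h
      push Not at h
      have := Real.log_nonpos ht0.le h
      linarith
    have hl0 : Real.log t ≠ 0 := by linarith
    have hφ0 : Real.log x / Real.log t - 1 ≠ 0 := by linarith
    have hden0 : t * Real.log t ^ 2 ≠ 0 := mul_ne_zero ht0.ne' (pow_ne_zero 2 hl0)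
    have hφ := hasDerivAt_logRatio_sub_one x ht1
    have hω := hasDerivAt_buchstabOmega hφ2
    have hcomp := hω.comp t hφ
    have hden := (hasDerivAt_id' t).fun_mul ((Real.hasDerivAt_log ht0.ne').fun_pow 2)
    have h := (hcomp.const_mul x).fun_div hden hden0
    refine h.congr_deriv ?_
    have ht0' : t ≠ 0 := ht0.ne'
    rw [hf'_def]
    simp only [Function.comp, Nat.cast_ofNat]
    rw [show (2 : ℕ) - 1 = 1 from rfl, pow_one]
    field_simp
  have hf'c : ContinuousOn f' (Icc a b) := by
    intro t ht
    obtain ⟨ht0, hlt, hφ2⟩ := aux_mem_three hk ha hbx ht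
    have h1 : t ≠ 0 := ht0.ne'
    have hl0 : Real.log t ≠ 0 := by linarith
    have hφ0 : Real.log x / Real.log t - 1 ≠ 0 := by linarith
    have h2 : (t * Real.log t ^ 2) ^ 2 ≠ 0 := pow_ne_zero 2 (mul_ne_zero h1 (pow_ne_zero 2 hl0))
    have hφc : ContinuousAt (fun y : ℝ => Real.log x / Real.log y - 1) t := by
      fun_prop (disch := assumption)
    have hA : ContinuousAt (fun y : ℝ => buchstabOmega (Real.log x / Real.log y - 1)) t :=
      (continuousAt_buchstabOmega (by linarith)).comp hφc
    have hB : ContinuousAt (fun y : ℝ => buchstabOmega (Real.log x / Real.log y - 1 - 1)) t :=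
      (continuousAt_buchstabOmega (by linarith)).comp (hφc.sub continuousAt_const)
    refine ContinuousAt.continuousWithinAt ?_
    rw [hf'_def]
    refine ContinuousAt.div ?_ (by fun_prop (disch := assumption)) h2
    refine ContinuousAt.sub ?_ ?_
    · refine ContinuousAt.mul (ContinuousAt.mul continuousAt_const ?_) (by fun_prop (disch := assumption))
      refine ContinuousAt.mul (ContinuousAt.div (hB.sub hA) hφc hφ0) ?_
      have h3 : t * Real.log t ^ 2 ≠ 0 := mul_ne_zero h1 (pow_ne_zero 2 hl0)
      fun_prop (disch := assumption)
    · exact (continuousAt_const.mul hA).mul (by fun_prop (disch := assumption))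
  -- the bounds `|f| ≤ x/(t log² t)`, `|f'| ≤ (k + 4) x/(t² log² t)`
  have hfb : ∀ t ∈ Icc a b, |f t| ≤ x / (t * Real.log t ^ 2) := by
    intro t ht
    obtain ⟨ht0, hlt, -⟩ := aux_mem_three hk ha hbx ht
    rw [hf_def]
    simp only
    rw [abs_div, abs_mul, abs_of_nonneg hx, abs_of_nonneg (buchstabOmega_nonneg _),
      abs_of_pos (by positivity : 0 < t * Real.log t ^ 2)]
    calc x * buchstabOmega (Real.log x / Real.log t - 1) / (t * Real.log t ^ 2)
        ≤ x * 1 / (t * Real.log t ^ 2) := by gcongr; exact buchstabOmega_le_one _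
      _ = _ := by rw [mul_one]
  have hk0 : (0 : ℝ) ≤ k := Nat.cast_nonneg k
  have hf'b : ∀ t ∈ Icc a b, |f' t| ≤ (k + 4) * x / (t ^ 2 * Real.log t ^ 2) := by
    intro t ht
    obtain ⟨ht0, hlt, hφ2⟩ := aux_mem_three hk ha hbx ht
    have hlat : Real.log a ≤ Real.log t := Real.log_le_log ha0 ht.1
    set L := Real.log x with hL
    have hLt : L ≤ 2 * (k + 1) * Real.log t := hxa.trans (by gcongr)
    set ℓ := Real.log t with hℓ
    set φt := L / ℓ - 1 with hφt
    have hden_pos : 0 < t * ℓ ^ 2 := by positivity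
    have hω' : |(buchstabOmega (φt - 1) - buchstabOmega φt) / φt| ≤ 1 / 4 :=
      abs_deriv_buchstabOmega_le hφ2
    have hωle : |buchstabOmega φt| ≤ 1 := abs_buchstabOmega_le_one _
    rw [hf'_def]
    simp only
    rw [abs_div, abs_of_pos (by positivity : (0 : ℝ) < (t * ℓ ^ 2) ^ 2),
      div_le_div_iff₀ (by positivity) (by positivity)]
    -- the numerator is at most `x (L/4 + ℓ² + 2ℓ)`
    have h1 : |x * ((buchstabOmega (φt - 1) - buchstabOmega φt) / φt * (-L / (t * ℓ ^ 2))) *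
        (t * ℓ ^ 2)| ≤ x * (L / 4) := by
      rw [abs_mul, abs_mul, abs_mul, abs_of_nonneg hx, abs_of_pos hden_pos,
        show |-L / (t * ℓ ^ 2)| = L / (t * ℓ ^ 2) by
          rw [neg_div, abs_neg, abs_of_nonneg (by positivity)]]
      calc x * (|(buchstabOmega (φt - 1) - buchstabOmega φt) / φt| * (L / (t * ℓ ^ 2))) * (t * ℓ ^ 2)
          = x * |(buchstabOmega (φt - 1) - buchstabOmega φt) / φt| * L := by field_simp
        _ ≤ x * (1 / 4) * L := by gcongr
        _ = x * (L / 4) := by ring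
    have h2 : |x * buchstabOmega φt * (ℓ ^ 2 + 2 * ℓ)| ≤ x * (ℓ ^ 2 + 2 * ℓ) := by
      rw [abs_mul, abs_mul, abs_of_nonneg hx, abs_of_pos (by positivity : 0 < ℓ ^ 2 + 2 * ℓ)]
      calc x * |buchstabOmega φt| * (ℓ ^ 2 + 2 * ℓ) ≤ x * 1 * (ℓ ^ 2 + 2 * ℓ) := by gcongr
        _ = _ := by rw [mul_one]
    have hnum : |x * ((buchstabOmega (φt - 1) - buchstabOmega φt) / φt * (-L / (t * ℓ ^ 2))) *
        (t * ℓ ^ 2) - x * buchstabOmega φt * (ℓ ^ 2 + 2 * ℓ)| ≤ x * (L / 4 + ℓ ^ 2 + 2 * ℓ) := by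
      refine (abs_sub _ _).trans ?_
      calc _ ≤ x * (L / 4) + x * (ℓ ^ 2 + 2 * ℓ) := add_le_add h1 h2
        _ = _ := by ring
    have hkey : L / 4 + ℓ ^ 2 + 2 * ℓ ≤ (k + 4) * ℓ ^ 2 := by nlinarith
    calc |x * ((buchstabOmega (φt - 1) - buchstabOmega φt) / φt * (-L / (t * ℓ ^ 2))) * (t * ℓ ^ 2) -
          x * buchstabOmega φt * (ℓ ^ 2 + 2 * ℓ)| * (t ^ 2 * ℓ ^ 2)
        ≤ x * (L / 4 + ℓ ^ 2 + 2 * ℓ) * (t ^ 2 * ℓ ^ 2) := by gcongr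
      _ ≤ x * ((k + 4) * ℓ ^ 2) * (t ^ 2 * ℓ ^ 2) := by gcongr
      _ = (k + 4) * x * (t * ℓ ^ 2) ^ 2 := by ring
  have hres := abs_sum_sub_integral_le_of_weight_bounds hC₀ hE ha hab hba hx (by positivity) hf hf'c
    hfb hf'b
  have hsum : ∑ p ∈ (Finset.Ioc ⌊a⌋₊ ⌊b⌋₊).filter Nat.Prime, f p * Real.log p =
      ∑ p ∈ (Finset.Ioc ⌊a⌋₊ ⌊b⌋₊).filter Nat.Prime,
        x * buchstabOmega (Real.log x / Real.log p - 1) / (p * Real.log p) := by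
    refine Finset.sum_congr rfl fun p hp => ?_
    have hp2 := (Finset.mem_filter.mp hp).2.two_le
    have hlp : Real.log p ≠ 0 := (Real.log_pos (by exact_mod_cast hp2)).ne'
    have hp0 : (p : ℝ) ≠ 0 := by positivity
    rw [hf_def]
    simp only
    field_simp
  rw [hsum] at hres
  calc _ ≤ _ := hres
    _ = (3 * k + 14) * C₀ * x / Real.log a ^ 2 := by ring

end Literature.NumberTheory.Sieve
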